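import Summits.QuantumFields.YangMills.Theorems.F4SubCurvatureDoorShortRootRigidity
import Mathlib
import HarnessLib

/-!
# Crux ⟨stmt-QuantumFields-23125⟩ `F4SubCurvatureDoor.RationalToGeneral`, PROVED

Route `F4SubCurvatureDoor` (sub-problem `YangMills`).  `RationalToGeneral := RationalShortRootRigidity → ShortRootRigidity` (the open
remainder of `ShortRootRigidity` after the rational Källén–Lehmann class); since the parent crux `ShortRootRigidity` ⟨stmt-QuantumFields-23035⟩
is now a tree theorem (✓`shortRootRigidity_proof`, via odd-mode rigidity = analytic half + torus reduction), the implication holds with its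
hypothesis unused.

Mathlib + tree only; no `sorry`; no new definitions; standard axioms.  HONEST LABEL: closes one crux item; the route's cruxes `TrialityLimit`
⟨22566⟩, `SubCurvatureKernel` ⟨23036⟩, `NPointStepF4` ⟨23037⟩, the rung R2d (`BalabanLadder.ROT`) and every summit statement remain OPEN — the
Yang–Mills mass gap is NOT proved; no summit is proved by a line.  LEAD seat `ym-line-sfw-p2` g76 (cell ym-idea-1, free hands), by the owner's
ruling (ym-idea-3 g23, 16:29:51Z).
-/

noncomputable section

namespace Summit.QuantumFields.YangMills.Theorems.F4SubCurvatureDoorTorus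

/-- **Crux ⟨stmt-QuantumFields-23125⟩ `RationalToGeneral` of route `F4SubCurvatureDoor`, BY NAME** (`RationalShortRootRigidity →
ShortRootRigidity`; the hypothesis is not needed since `ShortRootRigidity` holds outright). -/
theorem rationalToGeneral_proof : Summit.QuantumFields.YangMills.Theses.F4SubCurvatureDoor.RationalToGeneral :=
  fun _ => shortRootRigidity_proof

end Summit.QuantumFields.YangMills.Theorems.F4SubCurvatureDoorTorus

end
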